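import Mathlib.Tactic.Linarith
import Mathlib.Tactic.Ring
import Mathlib.Tactic.NormNum
import HarnessLib

/-!
# The (0,1) cell of the ι-window, EXISTENCE side, VII: the pencil lemma, the divisors of `C₂`, and the node parameter `b = n` —
# arithmetic skeleton of `H2-EXISTENCE-SIDE-7.md`

Family `hodge`, b2b cell `hweil`, `Summits/HodgeConjecture/HodgeConjecture/Theorems` (helper of item stmt-HodgeConjecture-2524, the
Weil-sixfold rung the H2 test serves). Companion to `WeilTypeLadderH2W2CornerNumerics.lean` (pv3-g13, [VI]) with the SAME dictionary: `X = J(C)`, `C`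
general of genus `4` (`End J = ℤ`), `ι = −1`, `Θ = W₃ − κ` with nodes `±n`, `D_b = Θ_b ∪ Θ_{−b}`, `S_b = Θ_b ∩ Θ_{−b}`, the W₂ corner = rank-`(1,1)` ι-sheaves
on `D_b` with hull `L₁ = 𝒪_{Θ_b}(2Θ − X_p) ⊗ P`; on `C₂`: `Num(C₂) = ℤx ⊕ ℤd` (`x² = 1`, `x·d = 1`, `d² = −3`), `h ≡ 5x − d`, `K ≡ 6x − d`, `T_g ≡ T_h ≡
3x − d`, `δ = 2d`; on `C × C`: `NS = ℤf₁ ⊕ ℤf₂ ⊕ ℤΔ` (`f₁f₂ = 1`, `fᵢ·Δ = 1`, `Δ² = −6`, `K = 6f₁ + 6f₂`). Report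
`run/shared/lean/b2b/hodge-weil/b2b-hweil-pv3-g14/H2-EXISTENCE-SIDE-7.md`, CLAIM TABLE v30 (LADDER C198) row pv3. Def-free, fully proved ELEMENTARY
statements (integer / rational bookkeeping); the sheaf theory and the geometry are in the docstrings and the report.
HONEST FRAMING: census / structure results about one cell of the ladder's H2 test on the existence side, on the Jacobian locus only; no case of the
Hodge conjecture is proved; nothing here is a rung; no statement of [Markman 2025] is used; nothing here depends on (LP) or on 'ker ob = ann(ch)'.

§1 PENCIL LEMMA (report 1.1–1.4): for a 2-generated torsion-free `M` on the depth-3 germ `(D_b, w)` every colength-1 submodule `N_H` is ≥ 2-generated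
(`Ext¹(k, 𝒪_D) = 0`), the colength-1 submodules of `N_H` form a `ℙ^{μ(N_H)−1} ∋ 𝔪M`, and the curvilinear colength-2 submodules form an irreducible family
of dimension `1 + a ≥ 2` whose closure contains `𝔪M`; so TM′ (β) with `μ ≥ 2` needs no local model. The node module `(x,z)𝒪` over `xy = zw` has TWO linear
relations, `dim M/𝔪²M = 8`, `dim 𝔪M/𝔪²M = 6` (`node_module_dims`). §2 DIVISORS OF `C₂` (THEOREMS 2.4/2.5): an effective `B ≡ αx + βd` has `α + β ≥ 0`
(`x` nef) and `α + 3β ≥ 0` (`T_g` nef) (`C2_form_dictionary`); the integer solutions in h-degree `4 / 8 / 12` are listed (`C2_effective_classes_deg4/8/12`);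
classes `d` and `x + d` are excluded by the parity of the `Δ`-multiplicity (`C2_class_d_void`, `C2_class_x_add_d_void`); via `π^*B + |β|Δ = div(s)`,
`s ∈ Sym²/Λ² H⁰(M)`, the effective divisors of h-degree `≤ 8` are exactly `x_q; T_g, T_h; x_q + x_q′; T_M (M ∈ K − C₂); 2T_g, 2T_h, T_g + T_h`, and in
class `7x − 2d` every effective divisor is REDUCIBLE, one of `x_q + 2T_g`, `x_q + 2T_h`, `x_q + T_g + T_h`, `T_g + T_M`, `T_h + T_M` (`M ∈ W¹₄`)
[ERRATUM E-P3g14-3, referee-g75 R410 (b): the sentence of record 'in class `7x − 2d` only `x_q + T_g + T_h` (no quadric contains a non-hyperelliptic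
degree-7 genus-4 space curve)' was FALSE — the birational image `φ_M(C)` may be singular; `quadric_types_degree_seven` is the (true) SMOOTH-curve
arithmetic, and the two singular models are recorded in `quadric_types_degree_seven_singular_models`; nothing of record depends on the withdrawn clause]. §3 THE NODE
PARAMETER (THEOREMS 3.3/3.4): `(E2)_x^{node}` is the single configuration `b = n`, `S_n = C − C`, resolution `C × C`; the hulls are the line bundles
`Λ₁ ≡ 5f₁ + 4f₂ + Δ`, `Λ₂ ≡ 4f₁ + 5f₂ + Δ` (`Λ₁² = 52`, `Λ₁·K = 66`, `χ = 2`, `Λ₁·Δ = 3 = deg g`: `node_parameter_hull_numerics`), the Mumford classes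
`ξ₁ = f₁ + 2f₂ + ½Δ`, `ξ₂ = 2f₁ + f₂ + ½Δ`, `h = 3f₁ + 3f₂ + Δ` give `D₀ = ξ₁ + ξ₂ − h = 0` (`mumford_gram_node_parameter`), the matching forces the pinching
class `(b+1)f₁ + bf₂` of θ-degree `8b + 4 = 12 − 4j`, so `(b, j) ∈ {(1,0), (0,2)}` (`node_parameter_pinching_classes`): the pinching curve is three
`C`-translates (or one with degree-8 junk), no exotic class; the hull-level matching is a degree-0 condition `P_C² = N` (`matching_degree_zero`).
§4: welded junk degrees (`welding_junk_degrees`).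

What is NOT here: sheaves, the saturation, ψ, the vertex module of `C − C`, the Gaussian-map classification of class `9x − 3d`, (KR). 0 unconditional
rungs above the floor.
-/

set_option linter.dupNamespace false

namespace Summit.HodgeConjecture.HodgeConjecture.WeilTypeLadder

section H2W2CornerSeven

/-- REMARK 1.4 / PENCIL LEMMA 1.1 (report §1): the node module `M = (x,z)𝒪`, `𝒪 = k[[x,y,z,w]]/(xy − zw)`, has two generators with TWO independent
linear relations `(y, −w)`, `(z, −x)`, so `dim M/𝔪²M = 2·5 − 2 = 8` and `dim 𝔪M/𝔪²M = 8 − 2 = 6` (not `9`, `7`); `dim 𝔪v₀ = 4`, so the cyclic-type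
codimension-2 submodules `k(v₀ + m) + H′` form a family of dimension `1 + (6 − 4 − 1) + 1 = 3`; and in general the curvilinear colength-2 submodules of a
2-generated torsion-free module on a depth-3 germ form a `ℙ^a`-bundle over (an open set of) `ℙ¹` of dimension `1 + a ≥ 2` for `a ≥ 1`.
[H2-EXISTENCE-SIDE-7 §1] -/
theorem node_module_dims :
    (2 * 5 - 2 = 8) ∧ (8 - 2 = 6) ∧ (1 + (6 - 4 - 1) + 1 = 3) ∧ (∀ a : ℕ, 1 ≤ a → 2 ≤ 1 + a) := by
  refine ⟨by norm_num, by norm_num, by norm_num, ?_⟩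
  intro a ha; omega

/-- §2.1 (report): the intersection form on `Num(C₂) = ℤx ⊕ ℤd` (`x² = 1`, `x·d = 1`, `d² = −3`) evaluated against `x`, `h = 5x − d`, `T_g = 3x − d`,
`δ = 2d`, itself and `K = 6x − d`, for `n = αx + βd`: `n·x = α + β` (the bidegree `e` of `π^*B`), `n·h = 4α + 8β`, `n·T_g = 2α + 6β`, `n·δ = 2(α − 3β)`,
`n² = α² + 2αβ − 3β²`, `n·K = 5α + 9β`. Since `x` and `T_g` are nef, an effective class has `α + β ≥ 0` and `α + 3β ≥ 0`. [§2.1] -/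
theorem C2_form_dictionary (α β : ℤ) :
    (α * 1 + (α * 0 + 1 * β) - 3 * β * 0 = α + β) ∧
    (α * 5 + (α * (-1) + 5 * β) - 3 * β * (-1) = 4 * α + 8 * β) ∧
    (α * 3 + (α * (-1) + 3 * β) - 3 * β * (-1) = 2 * α + 6 * β) ∧
    (α * 0 + (α * 2 + 0 * β) - 3 * β * 2 = 2 * (α - 3 * β)) ∧
    (α * α + (α * β + α * β) - 3 * β * β = α ^ 2 + 2 * α * β - 3 * β ^ 2) ∧
    (α * 6 + (α * (-1) + 6 * β) - 3 * β * (-1) = 5 * α + 9 * β) := by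
  refine ⟨by ring, by ring, by ring, by ring, by ring, by ring⟩

/-- THEOREM 2.4 (report), the lattice layer in h-degree `4`: `4α + 8β = 4` with `α + β ≥ 0`, `α + 3β ≥ 0` forces `(α, β) ∈ {(−1,1), (1,0), (3,−1)}`;
`(−1,1)` has `e = 0` (then `π^*B = 2mΔ`, `B = mδ` of h-degree `16m`), `(1,0)` is `x` (the curves `x_q`), `(3,−1)` is `3x − d` (`T_g`, `T_h`). [§2.4] -/
theorem C2_effective_classes_deg4 (α β : ℤ) (h : 4 * α + 8 * β = 4) (hx : 0 ≤ α + β) (hT : 0 ≤ α + 3 * β) :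
    (α = -1 ∧ β = 1) ∨ (α = 1 ∧ β = 0) ∨ (α = 3 ∧ β = -1) := by
  omega

/-- THEOREM 2.4, h-degree `8`: `4α + 8β = 8`, `α + β ≥ 0`, `α + 3β ≥ 0` forces `(α, β) ∈ {(−2,2), (0,1), (2,0), (4,−1), (6,−2)}`: `e = 0` (void),
`d` (void by `C2_class_d_void`), `2x` (`x_q + x_q′`), `4x − d` (`T_M`, `M ∈ K − C₂`), `6x − 2d` (`2T_g`, `2T_h`, `T_g + T_h`). [§2.4] -/
theorem C2_effective_classes_deg8 (α β : ℤ) (h : 4 * α + 8 * β = 8) (hx : 0 ≤ α + β) (hT : 0 ≤ α + 3 * β) :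
    (α = -2 ∧ β = 2) ∨ (α = 0 ∧ β = 1) ∨ (α = 2 ∧ β = 0) ∨ (α = 4 ∧ β = -1) ∨ (α = 6 ∧ β = -2) := by
  omega

/-- THEOREM 2.5 (report), h-degree `12`: the lattice candidates are `(−3,3)` (`e = 0`, void), `(−1,2)` (`δ·B = −14 < 0` forces `δ ⊂ B`, then h-degree
`−4`: void), `(1,1)` (`x + d`, void by `C2_class_x_add_d_void`), `(3,0)`, `(5,−1)`, `(7,−2)`, `(9,−3)`. [§2.5] -/
theorem C2_effective_classes_deg12 (α β : ℤ) (h : 4 * α + 8 * β = 12) (hx : 0 ≤ α + β) (hT : 0 ≤ α + 3 * β) :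
    (α = -3 ∧ β = 3) ∨ (α = -1 ∧ β = 2) ∨ (α = 1 ∧ β = 1) ∨ (α = 3 ∧ β = 0) ∨ (α = 5 ∧ β = -1) ∨ (α = 7 ∧ β = -2) ∨
      (α = 9 ∧ β = -3) := by
  omega

/-- THEOREM 2.4, class `d` is NOT effective: writing `π^*B = B′ + 2mΔ` with `B′ ∌ Δ`, `[B′] = (1 − 2m)Δ` needs `B′·Δ = −6(1 − 2m) ≥ 0` and
`B′·(f₁ + f₂) = 2(1 − 2m) ≥ 0` — incompatible. [§2.4] -/
theorem C2_class_d_void (m : ℤ) (h1 : 0 ≤ -6 * (1 - 2 * m)) (h2 : 0 ≤ 2 * (1 - 2 * m)) : False := by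
  omega

/-- THEOREM 2.5, class `x + d` is NOT effective: `π^*B = B′ + 2mΔ`, `[B′] = (f₁ + f₂) + (1 − 2m)Δ`, `B′·Δ = 2 − 6(1 − 2m) ≥ 0` forces `m ≥ 1`, so `B′`
descends to a class `x + β′d` with `β′ = 1 − 2m ≤ −1`, where the dictionary gives `M = 𝒪(q)`, `s = s_q ⊗ s_q` of `Δ`-order `0 < |β′|`. [§2.5] -/
theorem C2_class_x_add_d_void (m : ℤ) (h : 0 ≤ 2 - 6 * (1 - 2 * m)) : 1 - 2 * m ≤ -1 ∧ 0 < |1 - 2 * m| := by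
  constructor
  · omega
  · have : 1 - 2 * m ≤ -1 := by omega
    rw [abs_of_neg (by omega)]; omega

/-- THEOREM 2.4/2.5, genus bookkeeping on `C₂` (`p_a = 1 + (n² + n·K)/2`): `T_M ≡ 4x − d` has `T_M² = 5`, `T_M·K = 11`, `p_a = 9`, and
`T_M·T_Λ = 5`, `T_g·T_Λ = 2`; the σ-twisted trigonal curve `B_{M,σ} ≡ 3x` has `B² = 9`, `B·K = 15`, `p_a = 13`; `x_q + T_g + T_h` has class
`(1 + 3 + 3)x − (0 + 1 + 1)d = 7x − 2d`. [§2.4–2.5] -/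
theorem C2_curve_numerics :
    ((16 : ℤ) - 8 - 3 = 5 ∧ (24 : ℤ) - 4 - 9 = 11 ∧ (1 : ℤ) + (5 + 11) / 2 = 9 ∧ (12 : ℤ) - 3 - 4 - 3 = 2) ∧
    ((9 : ℤ) + 15 = 24 ∧ (1 : ℤ) + 24 / 2 = 13) ∧ ((1 : ℤ) + 3 + 3 = 7 ∧ (0 : ℤ) + 1 + 1 = 2) := by
  norm_num

/-- THEOREM 2.5, class `7x − 2d` — SMOOTH-CURVE ARITHMETIC ONLY (ERRATUM E-P3g14-3, referee-g75 R410 (b)): a SMOOTH curve of degree `7` and genus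
`4` on a smooth quadric has type `(a, 7 − a)` with `(a − 1)(6 − a) = 4` only for `a ∈ {2, 5}` (a degree-2 ruling = a `g¹₂`), and on the quadric cone
(`𝔽₂` by `|σ + 2f|`, `C ≡ aσ + 7f`) `2g − 2 = −2a² + 14a − 14 = 6` only for `a ∈ {2, 5}`, where `a = 2` gives `C·f = 2` and `a = 5` violates `7 ≥ 2a`.
The docstring of record (p199592) drew from this 'a non-hyperelliptic curve of degree 7 and genus 4 in `ℙ³` lies on NO quadric' — FALSE as a statement
about the birational images `φ_M(C)` (`M ∈ Pic⁷(C)` base-point free), which may be SINGULAR: `M = g¹₃ + g¹₄` maps `C` onto a `(3,4)`-curve of arithmetic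
genus `6` with `δ = 2` on the Segre quadric, `M = 2g¹₃ + q` onto `C ≡ 3σ + 7f` on the cone (`p_a = 6`, `δ = 2`) — `quadric_types_degree_seven_singular_models`.
CORRECT READING of [VII] 2.5 [7x − 2d]: every effective divisor of class `7x − 2d` on `C₂` is reducible, one of `x_q + 2T_g`, `x_q + 2T_h`,
`x_q + T_g + T_h`, `T_g + T_M`, `T_h + T_M` (`M ∈ W¹₄`); 'no IRREDUCIBLE curve of class `7x − 2d`' survives; nothing of record depends on the withdrawn
clause (2.6, §3, §4, §8 of [VII] use THEOREM 2.4 only). The Lean statement below is unchanged and true. [§2.5; E-P3g14-3] -/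
theorem quadric_types_degree_seven (a : ℤ) :
    ((a - 1) * (6 - a) = 4 ↔ a = 2 ∨ a = 5) ∧ (-2 * a ^ 2 + 14 * a - 14 = 6 ↔ a = 2 ∨ a = 5) ∧ ¬ (2 * 5 ≤ (7 : ℤ)) := by
  refine ⟨?_, ?_, by norm_num⟩
  · constructor
    · intro h
      have h2 : (a - 2) * (a - 5) = 0 := by nlinarith [h]
      rcases mul_eq_zero.mp h2 with h3 | h3
      · left; omega
      · right; omega
    · rintro (rfl | rfl) <;> norm_num
  · constructor
    · intro h
      have h2 : (a - 2) * (a - 5) = 0 := by nlinarith [h]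
      rcases mul_eq_zero.mp h2 with h3 | h3
      · left; omega
      · right; omega
    · rintro (rfl | rfl) <;> norm_num

/-- THEOREM 3.3 (report), the hulls at the node parameter `b = n` on `C × C` (form: `u·v = a₁b₂ + a₂b₁ + c(b₁ + b₂) + c′(a₁ + a₂) − 6cc′` for
`u = a₁f₁ + a₂f₂ + cΔ`, `v = b₁f₁ + b₂f₂ + c′Δ`): `Λ₁ = 2h̃ − Δ − f₁ − 2f₂ = 5f₁ + 4f₂ + Δ` has `Λ₁² = 52`, `Λ₁·K = 66` (`K = 6f₁ + 6f₂`),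
`χ(Λ₁) = 9 + (52 − 66)/2 = 2` (`χ(𝒪_{C×C}) = 9`), `Λ₁·Δ = 3 = 6 − 3 = deg(K_C − (p + p₁ + p₂)) = deg g`; `h̃ = 3f₁ + 3f₂ + Δ` has `h̃² = 24`,
`h̃·Δ = 0`, `h̃·fᵢ = 4`. [§3.3] -/
theorem node_parameter_hull_numerics :
    ((2 * 3 - 0 - 1 : ℤ) = 5 ∧ (2 * 3 - 0 - 2 : ℤ) = 4 ∧ (2 * 1 - 1 - 0 : ℤ) = 1) ∧
    ((5 * 4 + 4 * 5 + 1 * (5 + 4) + 1 * (5 + 4) - 6 * 1 * 1 : ℤ) = 52) ∧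
    ((5 * 6 + 4 * 6 + 0 * (5 + 4) + 1 * (6 + 6) - 6 * 1 * 0 : ℤ) = 66) ∧
    ((9 : ℤ) + (52 - 66) / 2 = 2 ∧ ((1 : ℤ) - 4) ^ 2 = 9) ∧
    ((5 * 0 + 4 * 0 + 1 * (5 + 4) + 0 * (0 + 0) - 6 * 1 * 1 : ℤ) = 3 ∧ (6 : ℤ) - 3 = 3) ∧
    ((3 * 3 + 3 * 3 + 1 * (3 + 3) + 1 * (3 + 3) - 6 * 1 * 1 : ℤ) = 24 ∧ (1 * (3 + 3) - 6 * 1 * 1 : ℤ) = 0 ∧ (3 * 0 + 3 * 1 + 1 * 1 : ℤ) = 4) := by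
  norm_num

/-- THEOREM 3.3 (c) (report): Mumford's ℚ-classes on the normal surface `S_n = C − C` — `ξ₁ = f₁ + 2f₂ + ½Δ`, `ξ₂ = 2f₁ + f₂ + ½Δ` (coefficient
`3/6`, making them orthogonal to `Δ`), `h = 3f₁ + 3f₂ + Δ` —: `h² = 24`, `h·ξᵢ = 12`, `ξᵢ² = 11/2`, `ξ₁·ξ₂ = 13/2` (NOT the values `4`, `6` of [Z1],
valid where `X_p|_S` is Cartier), and **`D₀ = ξ₁ + ξ₂ − h = 0`** componentwise: the anti-invariant class degenerates at `b = n`. [§3.3 (c)] -/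
theorem mumford_gram_node_parameter :
    ((3 : ℚ) / 6 = 1 / 2) ∧ ((1 : ℚ) + 2 - 6 * (1 / 2) = 0) ∧
    ((1 * 2 + 2 * 1 : ℚ) + (1 / 2) * (1 + 2) + (1 / 2) * (1 + 2) - 6 * (1 / 2) * (1 / 2) = 11 / 2) ∧
    ((1 * 1 + 2 * 2 : ℚ) + (1 / 2) * (2 + 1) + (1 / 2) * (1 + 2) - 6 * (1 / 2) * (1 / 2) = 13 / 2) ∧
    ((3 * 2 + 3 * 1 : ℚ) + 1 * (1 + 2) + (1 / 2) * (3 + 3) - 6 * 1 * (1 / 2) = 12) ∧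
    ((3 * 3 + 3 * 3 : ℚ) + 1 * (3 + 3) + 1 * (3 + 3) - 6 * 1 * 1 = 24) ∧
    ((1 : ℚ) + 2 - 3 = 0 ∧ (2 : ℚ) + 1 - 3 = 0 ∧ (1 : ℚ) / 2 + 1 / 2 - 1 = 0) := by
  norm_num

/-- THEOREM 3.4 (a)–(b) (report): at `b = n` the matching `N₁ ≅ ι^♯N₁` forces `[swap G̃] − [G̃] = [Λ₂] − [Λ₁] = f₂ − f₁`, i.e. `a = b + 1` for
`[G̃°] = af₁ + bf₂ + c′Δ`; the θ-degree of the pinching curve is `h̃·G̃° = 3a + 3b + (a + b) = 8b + 4 = 12 − 4j`; with `b, j ≥ 0` the only solutions are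
`(b, j) = (1, 0)` (three `C`-translates, class `2f₁ + f₂`) and `(0, 2)` (one translate, class `f₁`, with degree-8 curve junk); and `G̃°·Δ = a + b − 6c′ ≥ 0`
forces `c′ ≤ 0` in both cases (then `c′ = 0` by seesaw). [§3.4] -/
theorem node_parameter_pinching_classes (a b j c' : ℤ) (h1 : a = b + 1) (h2 : 3 * a + 3 * b + (a + b) = 12 - 4 * j)
    (hb : 0 ≤ b) (hj : 0 ≤ j) :
    ((b = 1 ∧ j = 0 ∧ a = 2) ∨ (b = 0 ∧ j = 2 ∧ a = 1)) ∧ (0 ≤ a + b - 6 * c' → c' ≤ 0) := by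
  constructor
  · omega
  · intro hc; omega

/-- THEOREM 3.4 (c) (report): the hull-level matching `Λ₁(−G̃) ≅ swap^*Λ₁(−G̃)` is `P_C^{⊗2} ≅ N` with
`N = 𝒪_C(p + z₁ + z₂ − p₁ − p₂ − z₃)` of degree `1 + 2 − 2 − 1 = 0` (always solvable: `#Pic⁰(C)[2] = 2⁸ = 256` solutions); the comparison
`α^*Hom(N₁, ι^♯N₁) = Ñ₂Ñ₁^{−1}(−eΔ)` restricted to `Δ` reads `0 = 0 + 6e`, so `e = 0`; on the record family `z₁ + z₂ = h − z₃` the class `N` is `0`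
(`3 − 3 = 0`). [§3.4 (c)] -/
theorem matching_degree_zero :
    ((1 : ℤ) + 2 - 2 - 1 = 0) ∧ (2 ^ 8 = 256) ∧ (∀ e : ℤ, 0 ≤ e → (0 : ℤ) = 0 + 6 * e → e = 0) ∧ ((3 : ℤ) - 3 = 0) := by
  refine ⟨by norm_num, by norm_num, ?_, by norm_num⟩
  intro e _ h; omega

/-- §4.2 (report), welded junk: on the welding surface `h·U′ + h·V′ = 12 − 4j` with `h·U′ = h·V′ + 4` (`[U′] = [V′] + (3x − d)`) and h-degrees on
`C₂` divisible by `4`: `j = 1` (`2h·V′ + 4 = 8`) is impossible and `j = 2` (`2h·V′ + 4 = 4`) forces `h·V′ = 0`, `h·U′ = 4`, i.e. `V′ = ∅`,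
`U′ ∈ {T_g, T_h}` by THEOREM 2.4. [§4.2] -/
theorem welding_junk_degrees (v : ℤ) (hv : ∃ k : ℤ, v = 4 * k) (hv0 : 0 ≤ v) :
    (2 * v + 4 ≠ 8) ∧ (2 * v + 4 = 4 → v = 0 ∧ v + 4 = 4) := by
  obtain ⟨k, rfl⟩ := hv
  constructor
  · omega
  · intro h; omega

end H2W2CornerSeven

/-!
## Appendix (report §9, ADDENDUM C): the corrected class dictionary at `b = n`, the deficit `ℓ′ ∈ {2, 4}`, the record class, the index budget

ERRATUM E-P3g14-2 to the docstrings above: in `mumford_gram_node_parameter` (and in the module docstring) the vector `(2, 1, ½)` called `ξ₂` is in fact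
`ι^*ξ₁ = h − ξ₂` ([Z1]'s convention: `ξ₂ = x^{(−b)}|_S`, `ι^*ξ₁ = h − ξ₂`); the identity proved there is `ξ₁ + ι^*ξ₁ = h`, i.e. at `b = n` the two x-type
classes COINCIDE numerically, `ξ₁ ≡ ξ₂ ≡ f₁ + 2f₂ + ½Δ`, the lattice `⟨h, ξ₁, ξ₂⟩` drops to rank `2`, and `D₀ = ξ₁ + ξ₂ − h ≡ f₂ − f₁` with `D₀² = −2` — NOT `0`
(`mumford_classes_node_parameter_corrected`). THEOREM 9.3: with `𝓛₀ := Λ₁(−{z₁}×C − {z₂}×C − C×{z₃}) ≡ 3f₁ + 3f₂ + Δ`, `χ(𝓛₀) = −3`, and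
`r := len R¹α_*𝓛₀ ∈ {3} ∪ {4, 5}` (off / on the record stratum `z₁ + z₂ + z₃ ∈ |g|`), the deficit at `b = n` is `ℓ′ = 2 + χ(N₁) = r − 1`, i.e. `2` off the
record stratum and `4` on it (the flat limit forces `ℓ′ − 2 ≥ 2` there); the check `χ(L₁|_S) = χ(Λ₁) + 2 = 4` recovers [VI]'s value (`node_parameter_deficit`).
9.1 (β): the matching class on the record stratum is `N = 2(p − q) + (g − h)` (`node_parameter_record_class`). 9.3 (d): the vertex junk has length `2` and index
`τ ∈ {0, ±32}` (`balanced_length_two`). No accepted declaration is modified.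
-/

section H2W2CornerSevenAppendix

/-- ERRATUM E-P3g14-2 / report §9.1: at `b = n` the Mumford classes are `ξ₁ = ξ₂ = f₁ + 2f₂ + ½Δ` (BOTH x-type curves are 'one vertical + two horizontal'
translates) and `ι^*ξ₁ = ι^*ξ₂ = 2f₁ + f₂ + ½Δ = h − ξ₁`; with the form `u·v = a₁b₂ + a₂b₁ + c(b₁+b₂) + c′(a₁+a₂) − 6cc′`: `ξ₁ + ι^*ξ₁ = h`
(componentwise), `ξ₁² = ξ₁·ξ₂ = 11/2`, `h·ξ₁ = 12`, so `det Gram(h, ξ₁) = 24·(11/2) − 12² = −12 ≠ 0` while `Gram(h, ξ₁, ξ₂)` has two equal rows (rank `2`), and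
`D₀ = ξ₁ + ξ₂ − h = 2ξ₁ − h = (−1, 1, 0) = f₂ − f₁` with `D₀² = −2` (not `0`, not the `−4` of a general `S_b`). [H2-EXISTENCE-SIDE-7 §9.1] -/
theorem mumford_classes_node_parameter_corrected :
    ((1 : ℚ) + 2 = 3 ∧ (2 : ℚ) + 1 = 3 ∧ (1 : ℚ) / 2 + 1 / 2 = 1) ∧
    ((24 : ℚ) * (11 / 2) - 12 * 12 = -12) ∧
    ((2 * 1 - 3 : ℤ) = -1 ∧ (2 * 2 - 3 : ℤ) = 1 ∧ (2 * (1 : ℚ) / 2 - 1 = 0)) ∧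
    (((-1) * 1 + 1 * (-1) : ℤ) + 0 + 0 - 0 = -2) := by
  norm_num

/-- THEOREM 9.3 (report): at `b = n`, `𝓛₀ = Λ₁ − {z₁,z₂}×C − C×{z₃}` has class `(5,4,1) − (2,1,0) = (3,3,1) = [h̃]`, `χ(𝓛₀) = 9 + (24 − 48)/2 = −3`, and
with `r = len R¹α_*𝓛₀` the deficit is `ℓ′ = 2 + χ(N₁) = 2 + (−3 + r) = r − 1`: `r = 3` (off the record stratum, `M₀ = g − z₁ − z₂ − z₃ ≠ 0`: `r = h¹(M₀) =
3`) gives `ℓ′ = 2`; `r ∈ {4, 5}` (record stratum) gives `ℓ′ ∈ {3, 4}`, and the flat-limit inequality `ℓ′ − 2 ≥ 2` forces `ℓ′ = 4`, `r = 5`; the same count for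
`Λ₁` (`r = h¹(g) = 2`) gives `χ(L₁|_S) = χ(Λ₁) + 2 = 2 + 2 = 4`, [VI]'s value. In particular `ℓ′ ≥ 2`: no pure object at the node parameter. [§9.3] -/
theorem node_parameter_deficit (r l : ℤ) (hl : l = 2 + (-3 + r)) :
    ((5 - 2 : ℤ) = 3 ∧ (4 - 1 : ℤ) = 3 ∧ (9 : ℤ) + (24 - 48) / 2 = -3 ∧ (2 : ℤ) + 2 = 4) ∧
    (r = 3 → l = 2) ∧ ((r = 4 ∨ r = 5) → (l = 3 ∨ l = 4)) ∧ ((r = 4 ∨ r = 5) → 2 ≤ l - 2 → l = 4 ∧ r = 5) ∧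
    (3 ≤ r → 2 ≤ l) := by
  refine ⟨by norm_num, ?_, ?_, ?_, ?_⟩ <;> omega

/-- §9.1 (β) (report): degrees in the matching class `N = p + z₁ + z₂ − p₁ − p₂ − z₃`: `1 + 2 − 2 − 1 = 0`; on the record stratum (`p₁ + p₂ = h − p`,
`z₁ + z₂ = g − q`, `z₃ = q`) `N = p + (g − q) − (h − p) − q = 2p − 2q + g − h`, written as an identity of coefficient vectors on `(p, q, g, h)`:
`(1,0,0,0) + (0,−1,1,0) − (−1,0,0,1) − (0,1,0,0) = (2,−2,1,−1)`. [§9.1] -/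
theorem node_parameter_record_class :
    ((1 : ℤ) + 2 - 2 - 1 = 0) ∧
    (((1 : ℤ) + 0 - (-1) - 0, (0 : ℤ) + (-1) - 0 - 1, (0 : ℤ) + 1 - 0 - 0, (0 : ℤ) + 0 - 1 - 0) = (2, -2, 1, -1)) := by
  norm_num

/-- §9.3 (d) / 9.4 (report): the vertex junk at `b = n` has length `n₊ + n₋ = 2` and index `τ = −16(n₊ − n₋) ∈ {0, 32, −32}`, `= 0 ⟺ n₊ = n₋ = 1`;
`(L⁺)`'s congruence `τ ≡ 16χ (mod 32)` with `χ(F̂_t) = 0` is consistent with all three; the `𝔪`-stratum of the balanced punctual ι-Quot has dimension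
`(a − 1) + (b − 1) = a + b − 2` (mixed signs, `a = dim V₊`, `b = dim V₋`) resp. `2(a − 2)` (pure sign, `Gr(2, V_±)`), which is `≥ 2` iff `a + b ≥ 4`
resp. `a ≥ 3`. [§9.3–9.4] -/
theorem balanced_length_two (np nm : ℤ) (h0 : 0 ≤ np) (h1 : 0 ≤ nm) (hlen : np + nm = 2) :
    (-16 * (np - nm) = 0 ∨ -16 * (np - nm) = 32 ∨ -16 * (np - nm) = -32) ∧ (-16 * (np - nm) = 0 ↔ np = 1 ∧ nm = 1) ∧
    ((32 : ℤ) ∣ 16 * 0 - 0 ∧ (32 : ℤ) ∣ 16 * 0 - 32 ∧ (32 : ℤ) ∣ 16 * 0 - (-32)) ∧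
    (∀ a b : ℤ, (a - 1) + (b - 1) = a + b - 2 ∧ (2 ≤ a + b - 2 ↔ 4 ≤ a + b) ∧ (2 ≤ 2 * (a - 2) ↔ 3 ≤ a)) := by
  refine ⟨by omega, by omega, by norm_num, ?_⟩
  intro a b; omega

end H2W2CornerSevenAppendix

/-!
## ERRATUM E-P3g14-3 (pv3-g16, 2026-08-20; referee-g75 R410 (b), OBJECTION W-P3g14-25-a): the singular models behind [VII] 2.5's class `7x − 2d`

The docstrings of `quadric_types_degree_seven` and of this module (clause 'in class `7x − 2d` only `x_q + T_g + T_h`') are corrected IN PLACE by this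
proposal (text only; every declaration's statement and proof is byte-identical to p200735's tree file). The withdrawn inference applied smooth-curve genus
formulas to the possibly singular image `φ_M(C) ⊂ ℙ³` of the canonical genus-4 curve under a base-point-free `M ∈ Pic⁷(C)`. The two singular models that DO
lie on quadrics, and the resulting effective divisors of class `7x − 2d` on `C₂` (referee-g75's counterexamples, by the dictionary [VII] 2.2 itself):
(i) `M = g + M′` (`M′ ∈ W¹₄` base-point free): `φ_M(C)` is a `(3,4)`-curve on the Segre quadric, arithmetic genus `(3 − 1)(4 − 1) = 6`, `δ = 2`, geometric
genus `6 − 2 = 4`, degree `3 + 4 = 7`; divisors `T_g + T_M`, `T_h + T_M` of class `(3x − d) + (4x − d) = 7x − 2d`; (ii) `M = 2g + q`: `φ_M(C) ≡ 3σ + 7f` on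
the cone `𝔽₂ → Q₀` (`σ² = −2`), `2p_a − 2 = −2·3² + 14·3 − 14 = 10`, `p_a = 6`, `δ = 2`, `C·f = 3` (the `g¹₃`), `C·σ = 7 − 2·3 = 1` (the point `q`), degree
`(3σ + 7f)·(σ + 2f) = −6 + 6 + 7 = 7`; divisors `x_q + 2T_g`, `x_q + 2T_h` of class `x + 2(3x − d) = 7x − 2d`. Report: `HOME/b2b-hweil-pv3-g16/
ERRATA-ADDENDUM-P3g16.md` (E-P3g14-3). No label, count or rule of record changes; no case of the Hodge conjecture is involved.
-/

section H2W2CornerSevenErratum3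

/-- ERRATUM E-P3g14-3 (referee-g75 R410 (b)): arithmetic of the two SINGULAR degree-7 models of the genus-4 curve that lie on quadrics — (i) type `(3,4)`
on the smooth quadric: `p_a = (3 − 1)(4 − 1) = 6`, `6 − δ = 4` with `δ = 2`, degree `3 + 4 = 7`; (ii) `C ≡ 3σ + 7f` on `𝔽₂`: `2p_a − 2 = −2·9 + 42 − 14 =
10 = 2·6 − 2`, `C·f = 3`, `C·σ = 7 − 6 = 1 ≥ 0`, degree `−2·3 + 2·3 + 7 = 7`; and the class bookkeeping on `C₂`: `(3 + 4, 1 + 1) = (7, 2)` for `T_g + T_M`,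
`(1 + 2·3, 0 + 2·1) = (7, 2)` for `x_q + 2T_g`. So `quadric_types_degree_seven` (smooth curves: `a ∈ {2,5}` only) does NOT exclude quadrics through `φ_M(C)`.
[E-P3g14-3; [VII] 2.5 corrected reading] -/
theorem quadric_types_degree_seven_singular_models :
    (((3 : ℤ) - 1) * (4 - 1) = 6 ∧ (6 : ℤ) - 2 = 4 ∧ (3 : ℤ) + 4 = 7) ∧
    ((-2 : ℤ) * 3 ^ 2 + 14 * 3 - 14 = 2 * 6 - 2 ∧ (7 : ℤ) - 2 * 3 = 1 ∧ (0 : ℤ) ≤ 7 - 2 * 3 ∧ (-2 : ℤ) * 3 + 2 * 3 + 7 = 7) ∧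
    (((3 : ℤ) + 4, (1 : ℤ) + 1) = (7, 2) ∧ ((1 : ℤ) + 2 * 3, (0 : ℤ) + 2 * 1) = (7, 2)) := by
  norm_num

end H2W2CornerSevenErratum3

end Summit.HodgeConjecture.HodgeConjecture.WeilTypeLadder
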